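import Mathlib
import Summits.QuantumFields.BalabanUV.Beta.AccretiveCombesThomasBudget
import Summits.QuantumFields.BalabanUV.Beta.UnitLatticeWalkInversion
import Literature.NumberTheory.Sieve.BombieriAsymptoticSieveMertens

/-!
# `Summit.QuantumFields.BalabanUV.Beta.UnitLatticeLocalInverse` — the LOCAL INVERSES of the unit-lattice walk
# inversion CONSTRUCTED: compression of `1 + K′` to an enlarged cube `□̃`, inversion there by the accretive
# Combes–Thomas bound, extension by zero; the two algebraic properties the spine consumes
# (`P_□L_□ = L_□`, `P_□(1 + K′)P_□L_□ = P_□`) and the budget `WRS κ d L_□ ≤ C_L` from accretivity + decay of `K′`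

HONEST FRAMING (page 1 of everything in this cell).  Discharging `FlowStep.BetaPertH` would make
Bałaban's ultraviolet stability UNCONDITIONAL — a constructive-QFT result; it is NOT the continuum
limit and NOT the Clay problem.  This module discharges nothing of `BetaPertH`; [folklore] linear algebra,
kernel-checked (unit `b2b-balaban-beta-d4-p3`, road P3 «reduction road», gen 3; kernel leaf A3-local of the road's
re-cut of NODE A, skeleton v1.5 §7; companion of `UnitLatticeWalkInversion` (spine, local inverses as
hypothesis-objects) and `AccretiveCombesThomas(Budget)` (the accretive bound)).
HONEST DEPENDENCY: continuum YM on T⁴ ⇐ BetaPertH ∧ nine spine estimates (0/9 proved); BetaPertH ⇐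
(D1) ∧ (D4) ∧ CAP+tail; G-an2-4 gates asym, D1 and NE2/3/4.

CONTENTS (all PROVED, 0 sorry).
* §1 `compress A S` (`= A.submatrix` to the subtype of the finset `S`), `extend N` (by zero), and the algebra:
  `Pj_mul_extend` (`P_S·extend N = extend N`), `Pj_mul_mul_Pj_mul_extend_inv` (`P_S A P_S · extend((compress A S)⁻¹)
  = P_S` when the compression is invertible) — the two hypotheses `hPL`, `hinv` of `UnitLatticeWalkInversion`;
* §2 transfer of the hypotheses of the accretive bound to the compression: `Re`-coercivity (`reCoercive_compress`:
  a vector on `S` extended by zero), exponential row ∕ column defects (`expRowDefect_compress_le`: sub-sums);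
  the LINEAR-IN-RATE defect bound `expRowDefect_le_of_decay_linear` (`|e^{t} − 1| ≤ |t|e^{|t|}`, the tree's
  `Literature.NumberTheory.Sieve.BombieriSieve.abs_exp_sub_one_le` BY NAME — gate dedup: a kernel with
  `‖K′(i,j)‖ ≤ θe^{−κ₀d(i,j)}` costs `κ·θ·L₁` at rate `κ`, `L₁ ≥ Σ_j d(i,j)e^{−(κ₀−κ)d(i,j)}` — the budget → 0 as the
  rate `κ → 0`, which is how a NOT-small `K′ = xK`, `x ≤ 2γ₁`, still has accretive local inverses at a rate
  `κ = κ(γ₁)`: «constants depending on d, L, γ₁ only», owner's OUTLINE A.3.2);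
* §3 `wrs_extend_inv_le`: `WRS κ d (extend((compress (1 + K′) S)⁻¹)) (m⁻¹·L)` from conjugated coercivity `m` of the
  compression along the weights `d(·, j)` at rate `κ₁ ≥ κ` and the profile `Σ_j e^{−(κ₁−κ)d(i,j)} ≤ L`
  (`AccretiveCombesThomas.norm_inv_apply_le` BY NAME on the subtype).
WHAT IS NOT HERE: the U-localisation refinement (near∕far splitting), any instance.  NOT summit progress.

ABSOLUTE RULE.  Nothing printed is cited; nothing of other lineages restated (BY NAME: `WRS`, `wrs`, `nsq`,
`conjForm`, `norm_inv_apply_le`, `expRowDefect`, `expColDefect`, `expWeight`).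
-/

open scoped BigOperators Matrix ComplexConjugate
open Finset Matrix

namespace Summit.QuantumFields.BalabanUV.Beta.UnitLatticeLocalInverse

open Summit.QuantumFields.BalabanUV.Beta.AccretiveCombesThomas
open Summit.QuantumFields.BalabanUV.Beta.AccretiveCombesThomasBudget
open Summit.QuantumFields.BalabanUV.Beta.UnitLatticeWalkInversion (Pj)
open Literature.MathematicalPhysics.QuantumFieldTheory.Balaban1983to89.B5Prop11Lower (nsq nsq_nonneg)
open Literature.MathematicalPhysics.QuantumFieldTheory.Balaban1983to89.B13PerturbativeStep (wrs WRS)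
open Literature.NumberTheory.Sieve (BombieriSieve.abs_exp_sub_one_le)

noncomputable section

variable {Y : Type*} [Fintype Y] [DecidableEq Y]

/-! ## §1 Compression to a cube, extension by zero, and the two algebraic properties -/

/-- The COMPRESSION of a unit-lattice kernel to the finset `S` (the enlarged cube `□̃`). [folklore] -/
def compress (A : Matrix Y Y ℂ) (S : Finset Y) : Matrix S S ℂ := A.submatrix Subtype.val Subtype.val

/-- EXTENSION BY ZERO of a kernel on `S` to the whole unit lattice. [folklore] -/
def extend {S : Finset Y} (N : Matrix S S ℂ) : Matrix Y Y ℂ :=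
  fun i j => if hi : i ∈ S then (if hj : j ∈ S then N ⟨i, hi⟩ ⟨j, hj⟩ else 0) else 0

omit [Fintype Y] in
/-- Entries of the extension inside `S`. [folklore] -/
theorem extend_apply_of_mem {S : Finset Y} (N : Matrix S S ℂ) {i j : Y} (hi : i ∈ S) (hj : j ∈ S) :
    extend N i j = N ⟨i, hi⟩ ⟨j, hj⟩ := by
  simp [extend, hi, hj]

omit [Fintype Y] in
/-- The extension vanishes on rows outside `S`. [folklore] -/
theorem extend_apply_of_not_mem_left {S : Finset Y} (N : Matrix S S ℂ) {i : Y} (hi : i ∉ S) (j : Y) :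
    extend N i j = 0 := by
  simp [extend, hi]

omit [Fintype Y] in
/-- The extension vanishes on columns outside `S`. [folklore] -/
theorem extend_apply_of_not_mem_right {S : Finset Y} (N : Matrix S S ℂ) (i : Y) {j : Y} (hj : j ∉ S) :
    extend N i j = 0 := by
  by_cases hi : i ∈ S <;> simp [extend, hi, hj]

omit [Fintype Y] in
/-- Entries of the cube projection. [folklore] -/
theorem Pj_apply {B : Type*} (E : B → Finset Y) (b : B) (i j : Y) :
    Pj E b i j = if i = j then (if i ∈ E b then (1 : ℂ) else 0) else 0 := by
  simp [Pj, Matrix.diagonal_apply]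

/-- `P_S · extend N = extend N` (the extension is supported in the rows of `S`). [folklore] -/
theorem Pj_mul_extend {B : Type*} (E : B → Finset Y) (b : B) (N : Matrix (E b) (E b) ℂ) :
    Pj E b * extend N = extend N := by
  ext i j
  rw [Pj, Matrix.diagonal_mul]
  by_cases hi : i ∈ E b
  · simp [hi]
  · simp [hi, extend_apply_of_not_mem_left N hi]

omit [DecidableEq Y] in
/-- A sum over the unit lattice of a function vanishing off `S` is the sum over the subtype `S`. [folklore] -/
theorem sum_eq_sum_subtype_of_support {𝕄 : Type*} [AddCommMonoid 𝕄] (S : Finset Y) (g : Y → 𝕄)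
    (hg : ∀ k, k ∉ S → g k = 0) : ∑ k, g k = ∑ k : S, g k := by
  rw [Finset.sum_coe_sort S g]
  exact (Finset.sum_subset (Finset.subset_univ S) fun k _ hk => hg k hk).symm

/-- **The local-inverse property**: `P_S A P_S · extend((compress A S)⁻¹) = P_S` when the compression is invertible.
[folklore] -/
theorem Pj_mul_mul_Pj_mul_extend_inv {B : Type*} (E : B → Finset Y) (b : B) (A : Matrix Y Y ℂ)
    (hU : IsUnit (compress A (E b))) :
    Pj E b * A * Pj E b * extend (compress A (E b))⁻¹ = Pj E b := by
  set S := E b with hS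
  set N := (compress A S)⁻¹ with hN
  have hmul : compress A S * N = 1 :=
    Matrix.mul_nonsing_inv _ ((Matrix.isUnit_iff_isUnit_det _).1 hU)
  ext i j
  rw [Matrix.mul_apply]
  have hPAP : ∀ k, (Pj E b * A * Pj E b) i k
      = (if i ∈ S then (1 : ℂ) else 0) * A i k * (if k ∈ S then 1 else 0) := by
    intro k
    rw [Matrix.mul_assoc, Pj, Matrix.diagonal_mul, Matrix.mul_diagonal]
    ring
  simp_rw [hPAP]
  by_cases hi : i ∈ S
  · by_cases hj : j ∈ S
    · have key : ∑ k, (if i ∈ S then (1 : ℂ) else 0) * A i k * (if k ∈ S then 1 else 0) * extend N k j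
          = ∑ k : S, compress A S ⟨i, hi⟩ k * N k ⟨j, hj⟩ := by
        rw [sum_eq_sum_subtype_of_support S _ (fun k hk => by simp [hk])]
        refine Finset.sum_congr rfl fun k _ => ?_
        have hk : (k : Y) ∈ S := k.2
        rw [extend_apply_of_mem N hk hj]
        simp [hi, hk, compress]
      rw [key, ← Matrix.mul_apply, hmul, Matrix.one_apply, Pj_apply]
      have hi' : i ∈ E b := hi
      by_cases hij : i = j
      · subst hij; simp [hi']
      · simp [hij]
    · have h0 : ∀ k, extend N k j = 0 := fun k => extend_apply_of_not_mem_right N k hj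
      have hij : i ≠ j := fun h => hj (h ▸ hi)
      simp [h0, Pj_apply, hij]
  · have hPj : Pj E b i j = 0 := by
      rw [Pj_apply]
      by_cases hij : i = j
      · simp [hij, ← hS, hij ▸ hi]
      · simp [hij]
    simp [hi, hPj]

/-! ## §2 Transfer of the accretive hypotheses to the compression -/

/-- Extension by zero of a vector on `S`. [folklore] -/
def extendVec {S : Finset Y} (z : S → ℂ) : Y → ℂ := fun k => if hk : k ∈ S then z ⟨k, hk⟩ else 0

/-- `‖extendVec z‖² = ‖z‖²`. [folklore] -/
theorem nsq_extendVec {S : Finset Y} (z : S → ℂ) : nsq (extendVec z) = nsq z := by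
  unfold nsq
  rw [sum_eq_sum_subtype_of_support S _ (fun k hk => by simp [extendVec, hk])]
  refine Finset.sum_congr rfl fun k _ => ?_
  simp [extendVec, k.2]

/-- The form of the compression at `z` is the form of `A` at the extension of `z`. [folklore] -/
theorem form_compress {S : Finset Y} (A : Matrix Y Y ℂ) (z : S → ℂ) :
    star z ⬝ᵥ (compress A S *ᵥ z) = star (extendVec z) ⬝ᵥ (A *ᵥ extendVec z) := by
  rw [star_dotProduct_mulVec_eq, star_dotProduct_mulVec_eq]
  rw [sum_eq_sum_subtype_of_support S _ (fun k hk => by simp [extendVec, hk])]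
  refine Finset.sum_congr rfl fun k _ => ?_
  rw [sum_eq_sum_subtype_of_support S _ (fun l hl => by simp [extendVec, hl])]
  refine Finset.sum_congr rfl fun l _ => ?_
  simp [extendVec, k.2, l.2, compress]

/-- **`Re`-coercivity passes to the compression** (test the global inequality at the extension by zero). [folklore] -/
theorem reCoercive_compress {S : Finset Y} (A : Matrix Y Y ℂ) {γ : ℝ}
    (hγ : ∀ z : Y → ℂ, γ * nsq z ≤ (star z ⬝ᵥ (A *ᵥ z)).re) (z : S → ℂ) :
    γ * nsq z ≤ (star z ⬝ᵥ (compress A S *ᵥ z)).re := by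
  rw [form_compress, ← nsq_extendVec]
  exact hγ _

/-- The conjugated form of the compression is the conjugated form of `A` at the extension (weights restricted).
[folklore] -/
theorem conjForm_compress {S : Finset Y} (A : Matrix Y Y ℂ) (κ : ℝ) (ρ : Y → ℝ) (z : S → ℂ) :
    conjForm (compress A S) κ (fun k => ρ k) z = conjForm A κ ρ (extendVec z) := by
  unfold conjForm
  rw [sum_eq_sum_subtype_of_support S _ (fun k hk => by simp [extendVec, hk])]
  refine Finset.sum_congr rfl fun k _ => ?_
  rw [sum_eq_sum_subtype_of_support S _ (fun l hl => by simp [extendVec, hl])]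
  refine Finset.sum_congr rfl fun l _ => ?_
  simp [extendVec, k.2, l.2, compress]

/-- **Conjugated coercivity passes to the compression.** [folklore] -/
theorem conjCoercive_compress {S : Finset Y} (A : Matrix Y Y ℂ) (κ : ℝ) (ρ : Y → ℝ) {m : ℝ}
    (hc : ∀ z : Y → ℂ, m * nsq z ≤ (conjForm A κ ρ z).re) (z : S → ℂ) :
    m * nsq z ≤ (conjForm (compress A S) κ (fun k => ρ k) z).re := by
  rw [conjForm_compress, ← nsq_extendVec]
  exact hc _

omit [DecidableEq Y] in
/-- **The LINEAR-IN-RATE defect bound**: `‖R(i,j)‖ ≤ θe^{−κ₀d(i,j)}`, `|ρ_i − ρ_j| ≤ d(i,j)`, `0 ≤ κ`, and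
`Σ_j d(i,j)e^{−(κ₀−κ)d(i,j)} ≤ L₁` ⇒ `expRowDefect R κ ρ i ≤ κ·θ·L₁` — the budget VANISHES as the rate `κ → 0`, so a kernel
that is not small (`K′ = xK`, `x ≤ 2γ₁`) still admits accretive local inverses at a small rate. [folklore] -/
theorem expRowDefect_le_of_decay_linear (R : Matrix Y Y ℂ) {κ κ₀ θ L₁ : ℝ} (hκ : 0 ≤ κ) (hθ : 0 ≤ θ) (ρ : Y → ℝ)
    (d : Y → Y → ℝ) (hρ : ∀ e e', |ρ e - ρ e'| ≤ d e e') (hR : ∀ e e', ‖R e e'‖ ≤ θ * Real.exp (-(κ₀ * d e e')))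
    (hL : ∀ e, ∑ e', d e e' * Real.exp (-((κ₀ - κ) * d e e')) ≤ L₁) (e : Y) :
    expRowDefect R κ ρ e ≤ κ * θ * L₁ := by
  have hw : ∀ e', expWeight κ ρ e e' ≤ κ * d e e' * Real.exp (κ * d e e') := by
    intro e'
    have hd : 0 ≤ d e e' := (abs_nonneg _).trans (hρ e e')
    have ht : |κ * (ρ e - ρ e')| ≤ κ * d e e' := by
      rw [abs_mul, abs_of_nonneg hκ]; exact mul_le_mul_of_nonneg_left (hρ e e') hκ
    calc expWeight κ ρ e e' = |Real.exp (κ * (ρ e - ρ e')) - 1| := rfl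
      _ ≤ |κ * (ρ e - ρ e')| * Real.exp |κ * (ρ e - ρ e')| := BombieriSieve.abs_exp_sub_one_le _
      _ ≤ κ * d e e' * Real.exp (κ * d e e') :=
          mul_le_mul ht (Real.exp_le_exp.2 ht) (Real.exp_pos _).le (mul_nonneg hκ hd)
  calc expRowDefect R κ ρ e = ∑ e', ‖R e e'‖ * expWeight κ ρ e e' := rfl
    _ ≤ ∑ e', θ * Real.exp (-(κ₀ * d e e')) * (κ * d e e' * Real.exp (κ * d e e')) :=
        Finset.sum_le_sum fun e' _ =>
          mul_le_mul (hR e e') (hw e') (expWeight_nonneg κ ρ e e') (mul_nonneg hθ (Real.exp_pos _).le)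
    _ = κ * θ * ∑ e', d e e' * Real.exp (-((κ₀ - κ) * d e e')) := by
        rw [Finset.mul_sum]
        refine Finset.sum_congr rfl fun e' _ => ?_
        have : Real.exp (-(κ₀ * d e e')) * Real.exp (κ * d e e') = Real.exp (-((κ₀ - κ) * d e e')) := by
          rw [← Real.exp_add]; ring_nf
        calc θ * Real.exp (-(κ₀ * d e e')) * (κ * d e e' * Real.exp (κ * d e e'))
            = κ * θ * (d e e' * (Real.exp (-(κ₀ * d e e')) * Real.exp (κ * d e e'))) := by ring
          _ = κ * θ * (d e e' * Real.exp (-((κ₀ - κ) * d e e'))) := by rw [this]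
    _ ≤ κ * θ * L₁ := mul_le_mul_of_nonneg_left (hL e) (mul_nonneg hκ hθ)

omit [DecidableEq Y] in
/-- Column version of `expRowDefect_le_of_decay_linear`. [folklore] -/
theorem expColDefect_le_of_decay_linear (R : Matrix Y Y ℂ) {κ κ₀ θ L₁ : ℝ} (hκ : 0 ≤ κ) (hθ : 0 ≤ θ) (ρ : Y → ℝ)
    (d : Y → Y → ℝ) (hρ : ∀ e e', |ρ e - ρ e'| ≤ d e e') (hR : ∀ e e', ‖R e e'‖ ≤ θ * Real.exp (-(κ₀ * d e e')))
    (hL : ∀ e', ∑ e, d e e' * Real.exp (-((κ₀ - κ) * d e e')) ≤ L₁) (e' : Y) :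
    expColDefect R κ ρ e' ≤ κ * θ * L₁ := by
  have hw : ∀ e, expWeight κ ρ e e' ≤ κ * d e e' * Real.exp (κ * d e e') := by
    intro e
    have hd : 0 ≤ d e e' := (abs_nonneg _).trans (hρ e e')
    have ht : |κ * (ρ e - ρ e')| ≤ κ * d e e' := by
      rw [abs_mul, abs_of_nonneg hκ]; exact mul_le_mul_of_nonneg_left (hρ e e') hκ
    calc expWeight κ ρ e e' = |Real.exp (κ * (ρ e - ρ e')) - 1| := rfl
      _ ≤ |κ * (ρ e - ρ e')| * Real.exp |κ * (ρ e - ρ e')| := BombieriSieve.abs_exp_sub_one_le _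
      _ ≤ κ * d e e' * Real.exp (κ * d e e') :=
          mul_le_mul ht (Real.exp_le_exp.2 ht) (Real.exp_pos _).le (mul_nonneg hκ hd)
  calc expColDefect R κ ρ e' = ∑ e, ‖R e e'‖ * expWeight κ ρ e e' := rfl
    _ ≤ ∑ e, θ * Real.exp (-(κ₀ * d e e')) * (κ * d e e' * Real.exp (κ * d e e')) :=
        Finset.sum_le_sum fun e _ =>
          mul_le_mul (hR e e') (hw e) (expWeight_nonneg κ ρ e e') (mul_nonneg hθ (Real.exp_pos _).le)
    _ = κ * θ * ∑ e, d e e' * Real.exp (-((κ₀ - κ) * d e e')) := by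
        rw [Finset.mul_sum]
        refine Finset.sum_congr rfl fun e _ => ?_
        have : Real.exp (-(κ₀ * d e e')) * Real.exp (κ * d e e') = Real.exp (-((κ₀ - κ) * d e e')) := by
          rw [← Real.exp_add]; ring_nf
        calc θ * Real.exp (-(κ₀ * d e e')) * (κ * d e e' * Real.exp (κ * d e e'))
            = κ * θ * (d e e' * (Real.exp (-(κ₀ * d e e')) * Real.exp (κ * d e e'))) := by ring
          _ = κ * θ * (d e e' * Real.exp (-((κ₀ - κ) * d e e'))) := by rw [this]
    _ ≤ κ * θ * L₁ := mul_le_mul_of_nonneg_left (hL e') (mul_nonneg hκ hθ)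

/-! ## §3 The budget of the extended local inverse -/

/-- **`WRS` of the extended local inverse**: conjugated coercivity `m > 0` of the compression along every weight
`k ↦ d(k, j)` (rate `κ₁ ≥ 0`, `d(j,j) = 0`) gives `‖(compress A S)⁻¹(i,j)‖ ≤ m⁻¹e^{−κ₁d(i,j)}` on `S`
(`AccretiveCombesThomas.norm_inv_apply_le` on the subtype), hence `WRS κ d (extend (compress A S)⁻¹) (m⁻¹·L)` at any
rate `κ` with profile `Σ_j e^{−(κ₁−κ)d(i,j)} ≤ L` (the rows outside `S` vanish). [folklore] -/
theorem wrs_extend_inv_le (S : Finset Y) (A : Matrix Y Y ℂ) (d : Y → Y → ℝ) (hd0 : ∀ j, d j j = 0)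
    {κ κ₁ m L : ℝ} (hκ₁ : 0 ≤ κ₁) (hm : 0 < m) (hL0 : 0 ≤ L)
    (hc : ∀ j : S, ∀ z : S → ℂ, m * nsq z ≤ (conjForm (compress A S) κ₁ (fun k : S => d k j) z).re)
    (hL : ∀ i, ∑ j, Real.exp (-((κ₁ - κ) * d i j)) ≤ L) :
    WRS κ d (extend (compress A S)⁻¹) (m⁻¹ * L) := by
  intro i
  by_cases hi : i ∈ S
  · have hent : ∀ j, ‖extend (compress A S)⁻¹ i j‖ ≤ m⁻¹ * Real.exp (-(κ₁ * d i j)) := by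
      intro j
      by_cases hj : j ∈ S
      · rw [extend_apply_of_mem _ hi hj]
        have h := norm_inv_apply_le (compress A S) (fun k l : S => d k l) (fun l => hd0 l) hκ₁ hm hc ⟨i, hi⟩ ⟨j, hj⟩
        calc ‖(compress A S)⁻¹ ⟨i, hi⟩ ⟨j, hj⟩‖ ≤ Real.exp (-(κ₁ * d i j)) / m := h
          _ = m⁻¹ * Real.exp (-(κ₁ * d i j)) := by rw [div_eq_inv_mul]
      · rw [extend_apply_of_not_mem_right _ i hj, norm_zero]
        positivity
    calc wrs κ d (extend (compress A S)⁻¹) i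
        ≤ ∑ j, m⁻¹ * Real.exp (-(κ₁ * d i j)) * Real.exp (κ * d i j) :=
          Finset.sum_le_sum fun j _ => mul_le_mul_of_nonneg_right (hent j) (Real.exp_pos _).le
      _ = m⁻¹ * ∑ j, Real.exp (-((κ₁ - κ) * d i j)) := by
          rw [Finset.mul_sum]
          refine Finset.sum_congr rfl fun j _ => ?_
          rw [mul_assoc, ← Real.exp_add]; ring_nf
      _ ≤ m⁻¹ * L := mul_le_mul_of_nonneg_left (hL i) (inv_nonneg.2 hm.le)
  · have h0 : wrs κ d (extend (compress A S)⁻¹) i = 0 := by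
      unfold wrs
      exact Finset.sum_eq_zero fun j _ => by rw [extend_apply_of_not_mem_left _ hi j, norm_zero, zero_mul]
    rw [h0]
    exact mul_nonneg (inv_nonneg.2 hm.le) hL0

end

end Summit.QuantumFields.BalabanUV.Beta.UnitLatticeLocalInverse
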